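import Summits.HodgeConjecture.HodgeConjecture.Theorems.SixfoldTableXCensusEllipticRows
import Literature.AlgebraicGeometry.HodgeTheory.QuarticCentreTimesSimpleCMSurfaceProductSpan
import Literature.NumberTheory.ComplexMultiplication.QuarticCMTraceFieldNoSharedImaginary
import Literature.NumberTheory.ComplexMultiplication.QuarticCMTraceFieldNoImaginaryQuadratic
import Literature.AlgebraicGeometry.HodgeTheory.QuarticCMTwoOneEigenvalueDegreeFour
import HarnessLib

/-!
# TABLE X (dimension 6) — row 25 `g6.S_ErxY4_E.D4.other ∕ .samefield`, NON-ALIGNED MEMBERS: `B = D` on every power, the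
# Hodge conjecture, and the census conclusions X2 ∕ X1 at EVERY `A ∼ S × Y` — KERNEL, no binder beyond the member datum
# (cell `pub-hodgeav-hg6`, req-37 (A) Q2b; eng-2 g7, lead g3 GO 2026-08-29T06:10:55Z, brick R25-4 of `HOME/jobs/ROW25-eng2g7/MEMO.md`)

HONEST FRAMING. HC, `HC_AV` (stmt-1333), `HC_CM` (stmt-3052) and the rung H2 are NOT proved and do not occur here. The
census nodes `TableX.SixfoldCodimTwoCensus` (X2) / `TableX.SixfoldCodimThreeCensus` (X1) of `SixfoldTableXCover` are OURS
(`@[conjecture]`), never asserted; moreover the members treated here lie INSIDE the residue class `𝒞 = CM ∪ K3P` of the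
cover (the K3P cell `ProdCMCell IsQuarticFieldTypeIVFourfold (dim = 2)` carries no alignment condition), so the nodes do not
even quantify over them: the X2 / X1 statements below are recorded for the dossier, not as a census move. What IS new is
that HC at these members no longer needs the cover's binder `hK3P` (`Ring2.Atlas.HodgeQuarticTypeIVFourfoldTimesCMSurface`):
it is a KERNEL THEOREM. KIND of `HC_CM`: ABSENT (`S` is CM but HC is obtained from `B = D`, not from `HC_CM`). No
definition, no `sorry`, no new named fact; typed ≠ proved.

THE MEMBERS (`HOME/TABLE-X-g6-v0.md` §1 row 25; J4 `jobs/J4-eng2/README.md`; `Ring2AtlasSixfolds` docstring (iii)): `X ∼ S × Y`,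
`Y` a SIMPLE abelian fourfold with `End⁰(Y) = E` a quartic CM field acting with signature `{(2,0),(1,1)}` (the tree's R10 class:
`finrank_ℚ End⁰(Y) = 4`, `φ ∈ End(Y)` with eigenvalues `μ₁ ↦ 1`, `μ̄₁ ↦ 1`, `μ₂ ↦ 2` on `H^{1,0}`, pairwise distinct), `S` a
SIMPLE CM abelian surface realising the CM type `Φ` of a quartic CM field `K`, and the pair NON-ALIGNED:
  **(hNA) no non-zero purely imaginary complex number lies in both `ℚ(μ₂)` (`= τ₀(E)`, the `(2,0)`-embedding) and the
  complex reflex field `K*_Φ = traceField Φ`.**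
Uniform invariant of record (lead g3 06:10:55Z): ALIGNED ⟺ `K*_Φ = τ₀(E)` (the K3 partners, TABLE X rows 23 ∕ 24 = residue
R-K3P, OPEN); row 25 = the non-aligned configurations (`F ≅ E` any type — `K*_Φ ≅ E^r`; `F ≅ E^r`, the two non-aligned
types — `K*_Φ = τ₁(E)`), on which the engines found `Hg = Hg(S) × Hg(Y)`, `B = D` (7 engines; J3 ∕ J6 control rows).

WHAT IS PROVED (all over the Literature theorem `isStablyNondegenerate_simpleCMSurface_prod_quarticCentre` of
`HodgeTheory/QuarticCentreTimesSimpleCMSurfaceProductSpan` (eng-2 g7, R25-2: product span by the Lie step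
`HodgeThetaAnnihilatorQuarticCentreTimesTorus` (R25-1) + Moonen–Zarhin Thm. (3.2) + R10's `B(Yⁿ) = D(Yⁿ)`), transported along
isogenies):
* §1 `isStablyNondegenerate_row25_of_notAligned` / `isDivisorGenerated_row25_of_notAligned`: every `A ∼ S × Y` (non-aligned) has
  `B•(A^{N+1}) = D•(A^{N+1}) ⊗ ℂ` for all `N`, in particular `B•(A) = D•(A) ⊗ ℂ`;
* §2 **`hodgeConjectureFor_row25_of_notAligned`** (+ the order `A ∼ Y × S`, + powers): the Hodge conjecture for every such `A`
  — UNCONDITIONAL, no displayed print binder, no `HC_CM`;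
* §3 `census_row25_of_notAligned`: the X2- and X1-conclusions at every such `A` (divisor summand alone; L8 entry points
  `codimTwoCensusAt_of_isIsogenous_of_divisorial` / `codimThreeCensusAt_of_isIsogenous_of_divisorial`), for the record.

THE SLIVER IS EMPTY (lead g3 2026-08-29T06:43:38Z ∕ 06:47:49Z, answer (s1)). The equivalence «hNA ⟺ μ₂ ∉ K*_Φ» could
a priori fail on the sliver {`E = ℚ(μ₂)` biquadratic, an imaginary quadratic `k ⊂ E` with `k ⊂ K*_Φ`, `μ₂ ∉ K*_Φ`}. With `S`
SIMPLE (the standing hypothesis `hSs` of every theorem here) that sliver has NO member: `S` simple ⟹ `Φ` primitive ⟹ `K` is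
cyclic or non-normal (not biquadratic; `isPrimitive_of_not_isGalois`, `QuarticCMTypes` trichotomy) ⟹ the reflex field `K*_Φ`
is a quartic CM field ≅ `K` (cyclic case) or non-normal (`not_isGalois_traceField`), whose only quadratic subfield is its
maximal REAL subfield — so no imaginary quadratic `k` lies in `K*_Φ`. Consequently for `E` biquadratic and `S` simple the
datum (hNA) holds automatically («biquadratic centre × simple CM surface» is always non-aligned, J4's «V4×C4, V4×D4: δ = 0»;
words only, not typed here), and there is no third residue sub-cell: aligned = `μ₂ ∈ K*_Φ` = rows 23 ∕ 24.

v2 (R25-3, same session). §5 **`hodgeConjectureFor_row25_sameField`** / `isStablyNondegenerate_row25_sameField`: the «samefield»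
sub-row 25a WITHOUT the datum (hNA) — binders `hKg : ¬ IsGalois ℚ K` (non-normal quartic CM field) and an embedding
`z : K →+* ℂ` with `z(K) = ℚ(μ₂)` (`End⁰(S) ≅ End⁰(Y)` inside `ℂ`); (hNA) is then the tree's
`QuarticCM.forall_eq_zero_of_fieldRange_eq_adjoin` (`NumberTheory/ComplexMultiplication/QuarticCMTraceFieldNoSharedImaginary`,
Shimura §8.4 (2)(C): `K* ≠ z(K)`), with (NOSQ) from the simplicity of `S`
(`mul_self_ne_algebraMap_of_isSimple_of_isCMTypeRealisation`). For 25b («other»: `K ≅ E^r`, non-aligned types) (hNA) stays the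
member datum — it is the definition of non-alignment there.

v3 (same session). §6 **`hodgeConjectureFor_row25_biquadraticCentre`** / `isStablyNondegenerate_row25_biquadraticCentre`: the members
with `E = ℚ(μ₂)` BIQUADRATIC — member data `h4μ : finrank ℚ ℚ⟮μ₂⟯ = 4` and `hbq : ∃ ϑ ∈ ℚ⟮μ₂⟯, ∃ q < 0, ϑ² = q` (an imaginary
quadratic number inside `E`) — need NO datum (hNA): it is eng-4 g9's `QuarticCM.forall_eq_zero_of_biquadratic`
(`QuarticCMTraceFieldNoImaginaryQuadratic`, p706032: `K*_Φ` of a non-biquadratic quartic CM field has no imaginary quadratic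
subfield) with (NOSQ) from the simplicity of `S`; this is the corollary of record of the sliver paragraph above.

READING (honest scope; three-clause form). (i) KERNEL: `B = D` on all powers and HC at EVERY member of the isogeny class of
`S × Y` for every non-aligned pair — unconditional, std axioms, no named fact; (ii) modulo NOTHING displayed beyond the member
datum (hNA) (for the «samefield» members `F ≅ E` it is dischargeable from `isEmpty_algHom_traceField` — brick R25-3, not in this
file; for the «other» members it is the definition of non-alignment); (iii) NOT proved: the ALIGNED members (rows 23 ∕ 24 =
R-K3P), the non-simple CM surfaces `Z × Y` of the K3P cell, the narrowing of the cover's binder `hK3P` (R25-5, lead/director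
call), HC / `HC_AV` / `HC_CM` / H2. No inhabitant is exhibited and none is invented. All declarations live in
`TableX.ProductRows` (lead g2 DEDUP RULE). Nothing here is a corollary of `HC_CM`; typed ≠ proved.
-/

set_option linter.dupNamespace false

noncomputable section

open CategoryTheory NumberField
open Literature.AlgebraicGeometry Literature.AlgebraicGeometry.Motives
open Literature.AlgebraicGeometry.Motives.AbelianVariety (IsIsogenous IsSimple powSucc powSucc_zero powSucc_succ)
open Literature.AlgebraicGeometry.HodgeTheory
open Literature.AlgebraicGeometry.ComplexMultiplication
open Literature.AlgebraicGeometry.Milne1999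
open Literature.AlgebraicTopology.SingularHomology
open Literature.Barriers.HodgeConjecture
open Literature.NumberTheory.ComplexMultiplication
open Literature.AlgebraicGeometry.Pohlmann1968
open Summit.HodgeConjecture.HodgeConjecture.Ring2.ClassTargets

namespace Summit.HodgeConjecture.HodgeConjecture.TableX.ProductRows

section Row25

variable {Y S : AbelianVariety ℂ} {φY : Y ⟶ Y} {μ₁ μ₂ : ℂ}
  {K : Type} [Field K] [NumberField K] [IsCMField K] {Φ : CMType K} {ιS : 𝓞 K →+* End S}
  {θ : K →+* Module.End ℂ (complexBetti S.X 1)}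

/-! ## §1 `B = D` on every power of every non-aligned member -/

/-- **TABLE X row 25, NON-ALIGNED: every `A ∼ S × Y` is stably nondegenerate** (`B•(A^{N+1}) = D•(A^{N+1}) ⊗ ℂ` for all `N`):
the Literature theorem `isStablyNondegenerate_simpleCMSurface_prod_quarticCentre` (R25-2) transported along the isogeny
(`IsStablyNondegenerate.of_isIsogenous`, van Geemen §3.6). UNCONDITIONAL under the member datum (hNA).
[cite: MoonenZarhin1999LowDim, §3 Thm. (3.2), Lemma (3.6) and §5 Case 2] [cite: vanGeemen1994HodgeAV, §3.6 and Lemma 3.7] -/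
theorem isStablyNondegenerate_row25_of_notAligned {A : AbelianVariety ℂ} (hYs : Y.IsSimple)
    (hE4 : Module.finrank ℚ Y.endAlgebra = 4) (h11 : starRingEnd ℂ μ₁ ≠ μ₁) (h22 : starRingEnd ℂ μ₂ ≠ μ₂) (h12 : μ₂ ≠ μ₁)
    (h12' : μ₂ ≠ starRingEnd ℂ μ₁) (h1 : eigenMultiplicity Y φY μ₁ = 1)
    (h1' : eigenMultiplicity Y φY (starRingEnd ℂ μ₁) = 1) (h2 : eigenMultiplicity Y φY μ₂ = 2) (hY4 : Y.dim = 4)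
    (hreal : IsCMTypeRealisation Φ S ιS θ) (hK4 : Module.finrank ℚ K = 4) (hSs : S.IsSimple)
    (hNA : ∀ w : ℂ, w ∈ IntermediateField.adjoin ℚ {μ₂} → w ∈ traceField Φ → starRingEnd ℂ w = -w → w = 0)
    (hA : IsIsogenous A (S.prod Y)) : IsStablyNondegenerate A :=
  (isStablyNondegenerate_simpleCMSurface_prod_quarticCentre hYs φY hE4 h11 h22 h12 h12' h1 h1' h2 hY4 hreal hK4 hSs
    hNA).of_isIsogenous hA

/-- **`B•(A) = D•(A) ⊗ ℂ` at every non-aligned row-25 member `A ∼ S × Y`.** UNCONDITIONAL under (hNA).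
[cite: MoonenZarhin1999LowDim, §3 Thm. (3.2) and §5 Case 2] [cite: vanGeemen1994HodgeAV, §2.4 and §3.6] -/
theorem isDivisorGenerated_row25_of_notAligned {A : AbelianVariety ℂ} (hYs : Y.IsSimple)
    (hE4 : Module.finrank ℚ Y.endAlgebra = 4) (h11 : starRingEnd ℂ μ₁ ≠ μ₁) (h22 : starRingEnd ℂ μ₂ ≠ μ₂) (h12 : μ₂ ≠ μ₁)
    (h12' : μ₂ ≠ starRingEnd ℂ μ₁) (h1 : eigenMultiplicity Y φY μ₁ = 1)
    (h1' : eigenMultiplicity Y φY (starRingEnd ℂ μ₁) = 1) (h2 : eigenMultiplicity Y φY μ₂ = 2) (hY4 : Y.dim = 4)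
    (hreal : IsCMTypeRealisation Φ S ιS θ) (hK4 : Module.finrank ℚ K = 4) (hSs : S.IsSimple)
    (hNA : ∀ w : ℂ, w ∈ IntermediateField.adjoin ℚ {μ₂} → w ∈ traceField Φ → starRingEnd ℂ w = -w → w = 0)
    (hA : IsIsogenous A (S.prod Y)) : IsDivisorGenerated A :=
  isStablyNondegenerate_row25_of_notAligned hYs hE4 h11 h22 h12 h12' h1 h1' h2 hY4 hreal hK4 hSs hNA hA 0

/-! ## §2 The Hodge conjecture at every non-aligned member — no binder -/

/-- **TABLE X ROW 25, NON-ALIGNED MEMBERS: THE HODGE CONJECTURE for every complex abelian variety isogenous to `S × Y`**, `Y`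
a simple abelian fourfold whose `End⁰` is a quartic CM field of signature `{(2,0),(1,1)}` (R10 class), `S` a simple CM abelian
surface of type `(K, Φ)`, the pair non-aligned (hNA) — UNCONDITIONAL: `B = D` (§1) with Lefschetz `(1,1)`
(`IsStablyNondegenerate.hodgeConjectureFor_of_isIsogenous_powSucc` at `N = 0`). No print binder, no `HC_CM`; the aligned
members (K3 partners, rows 23 ∕ 24) are NOT covered. [cite: MoonenZarhin1999LowDim, §3 Thm. (3.2), Lemma (3.6) and §5 Case 2]
[cite: vanGeemen1994HodgeAV, §2.4 and Lemma 3.7] -/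
theorem hodgeConjectureFor_row25_of_notAligned {A : AbelianVariety ℂ} (hYs : Y.IsSimple)
    (hE4 : Module.finrank ℚ Y.endAlgebra = 4) (h11 : starRingEnd ℂ μ₁ ≠ μ₁) (h22 : starRingEnd ℂ μ₂ ≠ μ₂) (h12 : μ₂ ≠ μ₁)
    (h12' : μ₂ ≠ starRingEnd ℂ μ₁) (h1 : eigenMultiplicity Y φY μ₁ = 1)
    (h1' : eigenMultiplicity Y φY (starRingEnd ℂ μ₁) = 1) (h2 : eigenMultiplicity Y φY μ₂ = 2) (hY4 : Y.dim = 4)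
    (hreal : IsCMTypeRealisation Φ S ιS θ) (hK4 : Module.finrank ℚ K = 4) (hSs : S.IsSimple)
    (hNA : ∀ w : ℂ, w ∈ IntermediateField.adjoin ℚ {μ₂} → w ∈ traceField Φ → starRingEnd ℂ w = -w → w = 0)
    (hA : IsIsogenous A (S.prod Y)) : HodgeConjectureFor A.dim A.X :=
  (isStablyNondegenerate_row25_of_notAligned hYs hE4 h11 h22 h12 h12' h1 h1' h2 hY4 hreal hK4 hSs hNA hA).hodgeConjectureFor

/-- **Row 25 in the order `A ∼ Y × S`** (`isIsogenous_prod_swap`). UNCONDITIONAL under (hNA).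
[cite: MoonenZarhin1999LowDim, §3 Thm. (3.2) and §5 Case 2] [cite: Milne1986AbelianVarieties, §12 Prop. 12.1 and p. 122] -/
theorem hodgeConjectureFor_row25_of_notAligned' {A : AbelianVariety ℂ} (hYs : Y.IsSimple)
    (hE4 : Module.finrank ℚ Y.endAlgebra = 4) (h11 : starRingEnd ℂ μ₁ ≠ μ₁) (h22 : starRingEnd ℂ μ₂ ≠ μ₂) (h12 : μ₂ ≠ μ₁)
    (h12' : μ₂ ≠ starRingEnd ℂ μ₁) (h1 : eigenMultiplicity Y φY μ₁ = 1)
    (h1' : eigenMultiplicity Y φY (starRingEnd ℂ μ₁) = 1) (h2 : eigenMultiplicity Y φY μ₂ = 2) (hY4 : Y.dim = 4)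
    (hreal : IsCMTypeRealisation Φ S ιS θ) (hK4 : Module.finrank ℚ K = 4) (hSs : S.IsSimple)
    (hNA : ∀ w : ℂ, w ∈ IntermediateField.adjoin ℚ {μ₂} → w ∈ traceField Φ → starRingEnd ℂ w = -w → w = 0)
    (hA : IsIsogenous A (Y.prod S)) : HodgeConjectureFor A.dim A.X :=
  hodgeConjectureFor_row25_of_notAligned hYs hE4 h11 h22 h12 h12' h1 h1' h2 hY4 hreal hK4 hSs hNA
    (hA.trans (isIsogenous_prod_swap Y S))

/-- **Every variety isogenous to a POWER `(S × Y)^{N+1}`** of a non-aligned row-25 pair satisfies the Hodge conjecture.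
[cite: MoonenZarhin1999LowDim, §3 Thm. (3.2) and §5 Case 2] [cite: vanGeemen1994HodgeAV, Lemma 3.7] -/
theorem hodgeConjectureFor_row25_powSucc_of_notAligned {A : AbelianVariety ℂ} {N : ℕ} (hYs : Y.IsSimple)
    (hE4 : Module.finrank ℚ Y.endAlgebra = 4) (h11 : starRingEnd ℂ μ₁ ≠ μ₁) (h22 : starRingEnd ℂ μ₂ ≠ μ₂) (h12 : μ₂ ≠ μ₁)
    (h12' : μ₂ ≠ starRingEnd ℂ μ₁) (h1 : eigenMultiplicity Y φY μ₁ = 1)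
    (h1' : eigenMultiplicity Y φY (starRingEnd ℂ μ₁) = 1) (h2 : eigenMultiplicity Y φY μ₂ = 2) (hY4 : Y.dim = 4)
    (hreal : IsCMTypeRealisation Φ S ιS θ) (hK4 : Module.finrank ℚ K = 4) (hSs : S.IsSimple)
    (hNA : ∀ w : ℂ, w ∈ IntermediateField.adjoin ℚ {μ₂} → w ∈ traceField Φ → starRingEnd ℂ w = -w → w = 0)
    (hA : IsIsogenous A ((S.prod Y).powSucc N)) : HodgeConjectureFor A.dim A.X :=
  hodgeConjectureFor_of_isIsogenous_powSucc_simpleCMSurface_prod_quarticCentre hYs φY hE4 h11 h22 h12 h12' h1 h1' h2 hY4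
    hreal hK4 hSs hNA hA

/-! ## §3 The census conclusions X2 ∕ X1 at every non-aligned member (for the dossier; row 25 lies inside `𝒞`) -/

/-- **The X2- and X1-conclusions at every `A ∼ S × Y`, non-aligned** (divisor summand alone: `B = D` at `A`, §1, through the
L8 entry points). `dim A = 6`. Row 25 lies inside the residue class `𝒞` of the cover, so this is a record, not a census move.
HC ∕ HC_AV NOT proved beyond §2; X2 ∕ X1 stay `@[conjecture]` globally. [cite: MoonenZarhin1999LowDim, §3 Thm. (3.2) and §5 (5.1), Case 2]
[cite: vanGeemen1994HodgeAV, Lemma 3.7] -/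
theorem census_row25_of_notAligned {A : AbelianVariety ℂ} (hYs : Y.IsSimple)
    (hE4 : Module.finrank ℚ Y.endAlgebra = 4) (h11 : starRingEnd ℂ μ₁ ≠ μ₁) (h22 : starRingEnd ℂ μ₂ ≠ μ₂) (h12 : μ₂ ≠ μ₁)
    (h12' : μ₂ ≠ starRingEnd ℂ μ₁) (h1 : eigenMultiplicity Y φY μ₁ = 1)
    (h1' : eigenMultiplicity Y φY (starRingEnd ℂ μ₁) = 1) (h2 : eigenMultiplicity Y φY μ₂ = 2) (hY4 : Y.dim = 4)
    (hreal : IsCMTypeRealisation Φ S ιS θ) (hK4 : Module.finrank ℚ K = 4) (hSs : S.IsSimple)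
    (hNA : ∀ w : ℂ, w ∈ IntermediateField.adjoin ℚ {μ₂} → w ∈ traceField Φ → starRingEnd ℂ w = -w → w = 0)
    (hA : IsIsogenous A (S.prod Y)) :
    A.dim = 6 ∧
    (∀ c : complexBetti A.X (2 * 2), IsRationalClass c → IsOfHodgeType A.dim A.X (2 * 2) 2 2 c →
      c ∈ divisorClassesSpan A.X A.dim 2 ⊔ Submodule.span ℂ {w' : complexBetti A.X (2 * 2) |
        ∃ (C : AbelianVariety ℂ) (g : A.X ⟶ C.X) (w : complexBetti C.X (2 * 2)), C.dim < A.dim ∧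
          IsRationalClass w ∧ IsOfHodgeType C.dim C.X (2 * 2) 2 2 w ∧ w' = complexBetti.map g (2 * 2) w}) ∧
    (∀ c : complexBetti A.X (2 * 3), IsRationalClass c → IsOfHodgeType A.dim A.X (2 * 3) 3 3 c →
      c ∈ divisorClassesSpan A.X A.dim 3 ⊔ Submodule.span ℂ {w' : complexBetti A.X (2 * 3) |
          ∃ (a : complexBetti A.X (2 * 2)) (b : complexBetti A.X (2 * 1)),
            IsRationalClass a ∧ IsOfHodgeType A.dim A.X (2 * 2) 2 2 a ∧ IsRationalClass b ∧
            IsOfHodgeType A.dim A.X (2 * 1) 1 1 b ∧ w' = cupProduct (two_mul_add_two_mul 2 1) a b} ⊔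
        Submodule.span ℂ {w' : complexBetti A.X (2 * 3) |
          ∃ (C : AbelianVariety ℂ) (g : A.X ⟶ C.X) (w : complexBetti C.X (2 * 3)), C.dim < A.dim ∧
            IsRationalClass w ∧ IsOfHodgeType C.dim C.X (2 * 3) 3 3 w ∧ w' = complexBetti.map g (2 * 3) w} ⊔
        Submodule.span ℂ {w' : complexBetti A.X (2 * 3) |
          ∃ (B' : AbelianVariety ℂ) (g : A.X ⟶ B'.X) (d : ℕ) (ψ : B' ⟶ B') (w : complexBetti B'.X (2 * 3)),
            B'.dim = 6 ∧ 0 < d ∧ ψ ≫ ψ = -(d • 𝟙 B') ∧ IsRationalClass w ∧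
            IsOfHodgeType B'.dim B'.X (2 * 3) 3 3 w ∧ w ∈ weilClassesOf B' ψ 3 d ∧
            w' = complexBetti.map g (2 * 3) w}) := by
  have hS2 : S.dim = 2 := by
    have h := finrank_eq_two_mul_dim_of_isCMTypeRealisation hreal
    omega
  have hD : IsDivisorGenerated A :=
    isDivisorGenerated_row25_of_notAligned hYs hE4 h11 h22 h12 h12' h1 h1' h2 hY4 hreal hK4 hSs hNA hA
  refine ⟨by rw [hA.dim_eq, Motives.AbelianVariety.dim_prod, hS2, hY4], ?_, ?_⟩
  · exact codimTwoCensusAt_of_isIsogenous_of_divisorial (IsIsogenous.refl A) (hD 2)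
  · exact codimThreeCensusAt_of_isIsogenous_of_divisorial (IsIsogenous.refl A) (hD 3)

/-! ## §5 The «samefield» sub-row 25a: `End⁰(S) ≅ End⁰(Y)` non-normal — no datum (hNA) needed -/

/-- **TABLE X row 25a («samefield»): every `A ∼ S × Y` is stably nondegenerate**, for `S` a simple CM surface whose (non-normal
quartic) CM field `K` embeds onto `ℚ(μ₂) = τ₀(End⁰ Y)` (`hz`), WITHOUT the datum (hNA): it is discharged by
`QuarticCM.forall_eq_zero_of_fieldRange_eq_adjoin` (Shimura §8.4 (2)(C): the reflex field is not a conjugate of `K`) with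
(NOSQ) from simplicity (`mul_self_ne_algebraMap_of_isSimple_of_isCMTypeRealisation`). UNCONDITIONAL.
[cite: Shimura1998, §8.4 Example (2)(C)] [cite: MoonenZarhin1999LowDim, §3 Thm. (3.2) and §5 Case 2] -/
theorem isStablyNondegenerate_row25_sameField {A : AbelianVariety ℂ} (hYs : Y.IsSimple)
    (hE4 : Module.finrank ℚ Y.endAlgebra = 4) (h11 : starRingEnd ℂ μ₁ ≠ μ₁) (h22 : starRingEnd ℂ μ₂ ≠ μ₂) (h12 : μ₂ ≠ μ₁)
    (h12' : μ₂ ≠ starRingEnd ℂ μ₁) (h1 : eigenMultiplicity Y φY μ₁ = 1)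
    (h1' : eigenMultiplicity Y φY (starRingEnd ℂ μ₁) = 1) (h2 : eigenMultiplicity Y φY μ₂ = 2) (hY4 : Y.dim = 4)
    (hreal : IsCMTypeRealisation Φ S ιS θ) (hK4 : Module.finrank ℚ K = 4) (hSs : S.IsSimple) (hKg : ¬ IsGalois ℚ K)
    (z : K →+* ℂ) (hz : z.toRatAlgHom.fieldRange = IntermediateField.adjoin ℚ {μ₂})
    (hA : IsIsogenous A (S.prod Y)) : IsStablyNondegenerate A :=
  isStablyNondegenerate_row25_of_notAligned hYs hE4 h11 h22 h12 h12' h1 h1' h2 hY4 hreal hK4 hSs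
    (QuarticCM.forall_eq_zero_of_fieldRange_eq_adjoin hK4 hKg
      (fun _ hy hy0 r => mul_self_ne_algebraMap_of_isSimple_of_isCMTypeRealisation hK4 hreal hSs hy hy0 r) Φ z hz) hA

/-- **TABLE X ROW 25a («samefield»): THE HODGE CONJECTURE for every `A ∼ S × Y`**, `Y` a simple fourfold with non-normal
quartic CM centre of signature `{(2,0),(1,1)}`, `S` a simple CM surface with the SAME field (`z(K) = ℚ(μ₂)`), ANY CM type —
UNCONDITIONAL, no datum, no binder, no `HC_CM`. [cite: Shimura1998, §8.4 Example (2)(C)]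
[cite: MoonenZarhin1999LowDim, §3 Thm. (3.2), Lemma (3.6) and §5 Case 2] [cite: vanGeemen1994HodgeAV, §2.4 and Lemma 3.7] -/
theorem hodgeConjectureFor_row25_sameField {A : AbelianVariety ℂ} (hYs : Y.IsSimple)
    (hE4 : Module.finrank ℚ Y.endAlgebra = 4) (h11 : starRingEnd ℂ μ₁ ≠ μ₁) (h22 : starRingEnd ℂ μ₂ ≠ μ₂) (h12 : μ₂ ≠ μ₁)
    (h12' : μ₂ ≠ starRingEnd ℂ μ₁) (h1 : eigenMultiplicity Y φY μ₁ = 1)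
    (h1' : eigenMultiplicity Y φY (starRingEnd ℂ μ₁) = 1) (h2 : eigenMultiplicity Y φY μ₂ = 2) (hY4 : Y.dim = 4)
    (hreal : IsCMTypeRealisation Φ S ιS θ) (hK4 : Module.finrank ℚ K = 4) (hSs : S.IsSimple) (hKg : ¬ IsGalois ℚ K)
    (z : K →+* ℂ) (hz : z.toRatAlgHom.fieldRange = IntermediateField.adjoin ℚ {μ₂})
    (hA : IsIsogenous A (S.prod Y)) : HodgeConjectureFor A.dim A.X :=
  (isStablyNondegenerate_row25_sameField hYs hE4 h11 h22 h12 h12' h1 h1' h2 hY4 hreal hK4 hSs hKg z hz hA).hodgeConjectureFor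

/-! ## §6 Biquadratic centre `E = ℚ(μ₂)`: no datum (hNA) needed -/

/-- **TABLE X row 25, `E = ℚ(μ₂)` BIQUADRATIC (member data `h4μ`, `hbq`), `S` simple: every `A ∼ S × Y` is stably nondegenerate**,
WITHOUT the datum (hNA) — discharged by `QuarticCM.forall_eq_zero_of_biquadratic` (the reflex field of the non-biquadratic quartic
`K` contains no imaginary quadratic number) with (NOSQ) from simplicity. UNCONDITIONAL. [cite: Shimura1998, §8.4 Example (2)]
[cite: MoonenZarhin1999LowDim, §3 Thm. (3.2) and §5 Case 2] -/
theorem isStablyNondegenerate_row25_biquadraticCentre {A : AbelianVariety ℂ} (hYs : Y.IsSimple)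
    (hE4 : Module.finrank ℚ Y.endAlgebra = 4) (h11 : starRingEnd ℂ μ₁ ≠ μ₁) (h22 : starRingEnd ℂ μ₂ ≠ μ₂) (h12 : μ₂ ≠ μ₁)
    (h12' : μ₂ ≠ starRingEnd ℂ μ₁) (h1 : eigenMultiplicity Y φY μ₁ = 1)
    (h1' : eigenMultiplicity Y φY (starRingEnd ℂ μ₁) = 1) (h2 : eigenMultiplicity Y φY μ₂ = 2) (hY4 : Y.dim = 4)
    (hreal : IsCMTypeRealisation Φ S ιS θ) (hK4 : Module.finrank ℚ K = 4) (hSs : S.IsSimple)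
    (h4μ : Module.finrank ℚ (IntermediateField.adjoin ℚ {μ₂}) = 4)
    (hbq : ∃ ϑ ∈ IntermediateField.adjoin ℚ {μ₂}, ∃ q : ℚ, q < 0 ∧ ϑ ^ 2 = (q : ℂ))
    (hA : IsIsogenous A (S.prod Y)) : IsStablyNondegenerate A :=
  isStablyNondegenerate_row25_of_notAligned hYs hE4 h11 h22 h12 h12' h1 h1' h2 hY4 hreal hK4 hSs
    (QuarticCM.forall_eq_zero_of_biquadratic hK4
      (fun _ hy hy0 r => mul_self_ne_algebraMap_of_isSimple_of_isCMTypeRealisation hK4 hreal hSs hy hy0 r) Φ h4μ hbq) hA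

/-- **TABLE X ROW 25, BIQUADRATIC CENTRE: THE HODGE CONJECTURE for every `A ∼ S × Y`**, `Y` a simple fourfold whose quartic CM
centre `E = ℚ(μ₂)` is biquadratic (`h4μ`, `hbq`), signature `{(2,0),(1,1)}`, `S` ANY simple CM surface — UNCONDITIONAL, no datum,
no binder, no `HC_CM` (J4: «V4×C4, V4×D4 mixed kinds: δ = 0»). [cite: Shimura1998, §8.4 Example (2)]
[cite: MoonenZarhin1999LowDim, §3 Thm. (3.2), Lemma (3.6) and §5 Case 2] [cite: vanGeemen1994HodgeAV, §2.4 and Lemma 3.7] -/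
theorem hodgeConjectureFor_row25_biquadraticCentre {A : AbelianVariety ℂ} (hYs : Y.IsSimple)
    (hE4 : Module.finrank ℚ Y.endAlgebra = 4) (h11 : starRingEnd ℂ μ₁ ≠ μ₁) (h22 : starRingEnd ℂ μ₂ ≠ μ₂) (h12 : μ₂ ≠ μ₁)
    (h12' : μ₂ ≠ starRingEnd ℂ μ₁) (h1 : eigenMultiplicity Y φY μ₁ = 1)
    (h1' : eigenMultiplicity Y φY (starRingEnd ℂ μ₁) = 1) (h2 : eigenMultiplicity Y φY μ₂ = 2) (hY4 : Y.dim = 4)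
    (hreal : IsCMTypeRealisation Φ S ιS θ) (hK4 : Module.finrank ℚ K = 4) (hSs : S.IsSimple)
    (h4μ : Module.finrank ℚ (IntermediateField.adjoin ℚ {μ₂}) = 4)
    (hbq : ∃ ϑ ∈ IntermediateField.adjoin ℚ {μ₂}, ∃ q : ℚ, q < 0 ∧ ϑ ^ 2 = (q : ℂ))
    (hA : IsIsogenous A (S.prod Y)) : HodgeConjectureFor A.dim A.X :=
  (isStablyNondegenerate_row25_biquadraticCentre hYs hE4 h11 h22 h12 h12' h1 h1' h2 hY4 hreal hK4 hSs h4μ hbq hA).hodgeConjectureFor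

/-- **v4: the member datum `h4μ` DISCHARGED.** `finrank ℚ ℚ⟮μ₂⟯ = 4` follows from the class binders of `Y`
(`finrank_adjoin_eq_four_of_quarticCM_twoOne`: `End_Hdg(H¹Y)` is a division algebra of rank `4`, so the minimal polynomial of
`φ_Y^*` is irreducible of degree `4` and is the minimal polynomial of `μ₂`); only the biquadraticity datum `hbq` remains.
[cite: Shimura1998, §5.1 Prop. 2 and §8.4 Example (2)] [cite: MoonenZarhin1999LowDim, §3 Thm. (3.2), Lemma (3.6) and §5 Case 2] -/
theorem isStablyNondegenerate_row25_biquadraticCentre' {A : AbelianVariety ℂ} (hYs : Y.IsSimple)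
    (hE4 : Module.finrank ℚ Y.endAlgebra = 4) (h11 : starRingEnd ℂ μ₁ ≠ μ₁) (h22 : starRingEnd ℂ μ₂ ≠ μ₂) (h12 : μ₂ ≠ μ₁)
    (h12' : μ₂ ≠ starRingEnd ℂ μ₁) (h1 : eigenMultiplicity Y φY μ₁ = 1)
    (h1' : eigenMultiplicity Y φY (starRingEnd ℂ μ₁) = 1) (h2 : eigenMultiplicity Y φY μ₂ = 2) (hY4 : Y.dim = 4)
    (hreal : IsCMTypeRealisation Φ S ιS θ) (hK4 : Module.finrank ℚ K = 4) (hSs : S.IsSimple)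
    (hbq : ∃ ϑ ∈ IntermediateField.adjoin ℚ {μ₂}, ∃ q : ℚ, q < 0 ∧ ϑ ^ 2 = (q : ℂ))
    (hA : IsIsogenous A (S.prod Y)) : IsStablyNondegenerate A :=
  isStablyNondegenerate_row25_biquadraticCentre hYs hE4 h11 h22 h12 h12' h1 h1' h2 hY4 hreal hK4 hSs
    (finrank_adjoin_eq_four_of_quarticCM_twoOne hYs hE4 φY h11 h22 h12 h12' (by rw [h1]; exact one_ne_zero)
      (by rw [h2]; exact two_ne_zero)).1 hbq hA

/-- **v4: HC for every `A ∼ S × Y` with `E = ℚ(μ₂)` biquadratic (`hbq`), NO degree datum.**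
[cite: Shimura1998, §5.1 Prop. 2 and §8.4 Example (2)] [cite: MoonenZarhin1999LowDim, §3 Thm. (3.2), Lemma (3.6) and §5 Case 2] -/
theorem hodgeConjectureFor_row25_biquadraticCentre' {A : AbelianVariety ℂ} (hYs : Y.IsSimple)
    (hE4 : Module.finrank ℚ Y.endAlgebra = 4) (h11 : starRingEnd ℂ μ₁ ≠ μ₁) (h22 : starRingEnd ℂ μ₂ ≠ μ₂) (h12 : μ₂ ≠ μ₁)
    (h12' : μ₂ ≠ starRingEnd ℂ μ₁) (h1 : eigenMultiplicity Y φY μ₁ = 1)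
    (h1' : eigenMultiplicity Y φY (starRingEnd ℂ μ₁) = 1) (h2 : eigenMultiplicity Y φY μ₂ = 2) (hY4 : Y.dim = 4)
    (hreal : IsCMTypeRealisation Φ S ιS θ) (hK4 : Module.finrank ℚ K = 4) (hSs : S.IsSimple)
    (hbq : ∃ ϑ ∈ IntermediateField.adjoin ℚ {μ₂}, ∃ q : ℚ, q < 0 ∧ ϑ ^ 2 = (q : ℂ))
    (hA : IsIsogenous A (S.prod Y)) : HodgeConjectureFor A.dim A.X :=
  (isStablyNondegenerate_row25_biquadraticCentre' hYs hE4 h11 h22 h12 h12' h1 h1' h2 hY4 hreal hK4 hSs hbq hA).hodgeConjectureFor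

end Row25

/-! ## §4 Audit: on path -/

/- Audit (on path): the conclusion of §2 is a case of the summit — the tree's
`WeilTypeLadder.hodgeConjectureFor_abelianVariety_of_hodgeConjecture`, not re-declared (gate dedup). -/
example (h : _root_.HodgeConjecture) (A : AbelianVariety ℂ) : HodgeConjectureFor A.dim A.X :=
  hcOnClass_of_hodgeConjecture (fun _ ↦ True) h A trivial

end Summit.HodgeConjecture.HodgeConjecture.TableX.ProductRows

end
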